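import Summits.FinalStateConjecture.FinalStateConjecture.Theorems.EIHFluxBalanceInertialRecessionStubFirstOrderDecay
import Summits.FinalStateConjecture.FinalStateConjecture.Theorems.EIHFluxBalanceInertialRecessionStubFirstOrderLie
import Summits.FinalStateConjecture.FinalStateConjecture.Theorems.EIHFluxBalanceInertialRecessionStubSlaving3FarFieldPrep
import Summits.FinalStateConjecture.FinalStateConjecture.Theorems.EIHFluxBalanceInertialRecessionBoostedDecay

/-!
# Route EIHFluxBalance — `InertialRecession` (E′), skeleton r13, stub `stub_firstOrderSlaving` (D),
# part 7: uniform bounds for a painted summand and its first-variation field on a thick shell,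
# and the reduced far-field bound

Helper file for the crux `stmt-FinalStateConjecture-17403` (E′), stub (D).

* `firstOrder_norm_iteratedFDeriv_comp_lorentz_le` — `‖Dᵏ(g ∘ Λ⁻¹(· − c))(x)‖ ≤ ‖Λ⁻¹‖ᵏ ‖Dᵏg(y)‖`;
* `firstOrder_variation_congr` — two rates `(A, d)`, `(A', d')` with the same rest-frame first
  variation on `{r_a > 0}` have lab first-variation fields with the same value and derivative;
* `firstOrder_shell_bounds` — **uniform bounds on a thick shell**: for bounded boosts, centre
  offsets `‖x − c‖ ≤ ρ` and rest-frame radius `≥ 2M > 0`, the first two derivatives of the painted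
  summand are bounded, and its lab first-variation field and derivative are bounded by a constant
  times the REDUCED rate `‖A e₀‖ + ‖d~‖ + ‖a · A e₃‖` (compactness of the rest-frame shell,
  `firstOrder_lie_reduce`);
* `firstOrder_far_variation_red` — the far-field decay of part 6 in terms of the reduced rate.

Elementary; no definitions, no named facts.
-/

set_option linter.dupNamespace false
set_option maxSynthPendingDepth 3

noncomputable section

open scoped Topology
open Filter Set Function Metric Literature.Geometry.Lorentzian
  Summit.FinalStateConjecture.FinalStateConjecture.Theorems

namespace Summit.FinalStateConjecture.FinalStateConjecture.Theorems.SublinearIsFree.Slaving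

/-! ### Iterated derivatives through the rest-frame map -/

/-- **Iterated derivatives through the rest-frame map**: for an open `O` containing
`y = Λ⁻¹(x − c)`, `‖Dᵏ (z ↦ g(Λ⁻¹(z − c)))(x)‖ ≤ ‖Λ⁻¹‖ᵏ ‖Dᵏ g(y)‖` (chain rule with the linear
automorphism `Λ⁻¹`, `ContinuousLinearEquiv.iteratedFDerivWithin_comp_right`). [folklore] -/
theorem firstOrder_norm_iteratedFDeriv_comp_lorentz_le {F : Type*} [NormedAddCommGroup F]
    [NormedSpace ℝ F] (L : lorentzGroup) (c x : E4) (g : E4 → F) {O : Set E4} (hO : IsOpen O)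
    (hx : poincareInv L c x ∈ O) (k : ℕ) :
    ‖iteratedFDeriv ℝ k (fun z ↦ g (poincareInv L c z)) x‖ ≤
      ‖(((L : E4 ≃L[ℝ] E4).symm : E4 →L[ℝ] E4))‖ ^ k * ‖iteratedFDeriv ℝ k g (poincareInv L c x)‖ := by
  set e : E4 ≃L[ℝ] E4 := (L : E4 ≃L[ℝ] E4).symm with he
  have hfun : (fun z ↦ g (poincareInv L c z)) = fun z ↦ (g ∘ e) (z - c) := rfl
  rw [hfun, iteratedFDeriv_comp_sub]
  have hy : e (x - c) ∈ O := hx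
  have hso : IsOpen (e ⁻¹' O) := hO.preimage e.continuous
  have h1 : iteratedFDeriv ℝ k (g ∘ e) (x - c) = iteratedFDerivWithin ℝ k (g ∘ e) (e ⁻¹' O) (x - c) :=
    (iteratedFDerivWithin_of_isOpen k hso (by exact hy)).symm
  rw [h1, e.iteratedFDerivWithin_comp_right g hO.uniqueDiffOn hy k, iteratedFDerivWithin_of_isOpen k hO hy]
  refine (ContinuousMultilinearMap.norm_compContinuousLinearMap_le _ _).trans ?_
  rw [Finset.prod_const, Finset.card_univ, Fintype.card_fin, mul_comm]
  rfl

/-! ### Changing the rate without changing the variation field -/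

-- the algebraic and the operator-norm instance paths on `E4 →L[ℝ] E4 →L[ℝ] ℝ` unify slowly
set_option synthInstance.maxHeartbeats 200000 in
/-- **Rates with the same rest-frame first variation have the same lab field (value and derivative).**
If `∂_{Ay+d} g + g(A·,·) + g(·,A·) = ∂_{A'y+d'} g + g(A'·,·) + g(·,A'·)` at every `y` with
`r_a(y) > 0`, then at every lab event with positive rest-frame radius the two lab first-variation
fields agree together with their first derivatives (they agree on a neighbourhood). [folklore] -/
theorem firstOrder_variation_congr (M a : ℝ) (L : lorentzGroup) {A A' : E4 →L[ℝ] E4} {d d' : E4}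
    (c : E4) {x : E4}
    (h : ∀ y : E4, 0 < Kerr.radius a y → ∀ v w : E4,
      fderiv ℝ (Kerr.bilin M a) y (A y + d) v w + Kerr.bilin M a y (A v) w + Kerr.bilin M a y v (A w) =
      fderiv ℝ (Kerr.bilin M a) y (A' y + d') v w + Kerr.bilin M a y (A' v) w +
        Kerr.bilin M a y v (A' w))
    (hx : 0 < Kerr.radius a (poincareInv L c x)) :
    (fun z ↦ (fderiv ℝ (Kerr.bilin M a) (poincareInv L c z) (A (poincareInv L c z) + d)).bilinearComp
          (((L : E4 ≃L[ℝ] E4).symm : E4 →L[ℝ] E4)) (((L : E4 ≃L[ℝ] E4).symm : E4 →L[ℝ] E4)) +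
        (Kerr.bilin M a (poincareInv L c z)).bilinearComp
          (A.comp (((L : E4 ≃L[ℝ] E4).symm : E4 →L[ℝ] E4))) (((L : E4 ≃L[ℝ] E4).symm : E4 →L[ℝ] E4)) +
        (Kerr.bilin M a (poincareInv L c z)).bilinearComp
          (((L : E4 ≃L[ℝ] E4).symm : E4 →L[ℝ] E4)) (A.comp (((L : E4 ≃L[ℝ] E4).symm : E4 →L[ℝ] E4))))
      =ᶠ[𝓝 x]
    (fun z ↦ (fderiv ℝ (Kerr.bilin M a) (poincareInv L c z) (A' (poincareInv L c z) + d')).bilinearComp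
          (((L : E4 ≃L[ℝ] E4).symm : E4 →L[ℝ] E4)) (((L : E4 ≃L[ℝ] E4).symm : E4 →L[ℝ] E4)) +
        (Kerr.bilin M a (poincareInv L c z)).bilinearComp
          (A'.comp (((L : E4 ≃L[ℝ] E4).symm : E4 →L[ℝ] E4))) (((L : E4 ≃L[ℝ] E4).symm : E4 →L[ℝ] E4)) +
        (Kerr.bilin M a (poincareInv L c z)).bilinearComp
          (((L : E4 ≃L[ℝ] E4).symm : E4 →L[ℝ] E4)) (A'.comp (((L : E4 ≃L[ℝ] E4).symm : E4 →L[ℝ] E4)))) := by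
  have hopen : IsOpen {z : E4 | 0 < Kerr.radius a (poincareInv L c z)} :=
    isOpen_lt continuous_const ((Kerr.continuous_radius a).comp (continuous_poincareInv L c))
  filter_upwards [hopen.mem_nhds hx] with z hz
  ext v w
  simp only [add_apply, ContinuousLinearMap.bilinearComp_apply, ContinuousLinearMap.comp_apply]
  exact h _ hz _ _

/-! ### Uniform bounds on a thick shell -/

/-- The rest-frame shell `{‖y‖ ≤ ρ, r_a(y) ≥ r}` is compact. [folklore] -/
theorem firstOrder_isCompact_restShell (a ρ r : ℝ) :
    IsCompact {y : E4 | ‖y‖ ≤ ρ ∧ r ≤ Kerr.radius a y} := by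
  have hclosed : IsClosed {y : E4 | ‖y‖ ≤ ρ ∧ r ≤ Kerr.radius a y} :=
    (isClosed_le continuous_norm continuous_const).inter
      (isClosed_le continuous_const (Kerr.continuous_radius a))
  refine Metric.isCompact_of_isClosed_isBounded hclosed ?_
  refine (Metric.isBounded_closedBall (x := (0 : E4)) (r := ρ)).subset fun y hy ↦ ?_
  rw [mem_closedBall, dist_zero_right]
  exact hy.1

-- the algebraic and the operator-norm instance paths on `E4 →L[ℝ] E4 →L[ℝ] ℝ` unify slowly
set_option synthInstance.maxHeartbeats 200000 in
set_option maxHeartbeats 800000 in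
/-- **Uniform bounds on a thick shell.** For `M`, `a`, `γ`, `ρ`, `r > 0` there is `B ≥ 0` such that for
every Lorentz `L` with `|(Le₀)⁰| ≤ γ`, every `η`-skew `A`, every `d`, every centre `c` and every
lab event `x` with `‖x − c‖ ≤ ρ` and rest-frame radius `≥ r > 0`: the first two derivatives of the
painted summand `boostedKerrBilin L c M a` at `x` have norm `≤ B`, and its lab first-variation field
`V` satisfies `‖V(x)‖ + ‖DV(x)‖ ≤ B (‖A e₀‖ + ‖d~‖ + ‖a · A e₃‖)` (continuity of the derivatives of
`g_{M,a}` on the compact rest-frame shell, `firstOrder_lie_reduce`). [cite: KerrSchild1965, §3] -/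
theorem firstOrder_shell_bounds (M a γ ρ : ℝ) {r : ℝ} (hr : 0 < r) :
    ∃ B : ℝ, 0 ≤ B ∧ ∀ (L : lorentzGroup) (A : E4 →L[ℝ] E4) (d c x : E4),
      |((L : E4 ≃L[ℝ] E4) (E4.basisVector 0)) 0| ≤ γ →
      (∀ u w : E4, Minkowski.bilin (A u) w + Minkowski.bilin u (A w) = 0) →
      ‖x - c‖ ≤ ρ → r ≤ Kerr.radius a (poincareInv L c x) →
      ‖fderiv ℝ (boostedKerrBilin L c M a) x‖ ≤ B ∧
      ‖fderiv ℝ (fderiv ℝ (boostedKerrBilin L c M a)) x‖ ≤ B ∧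
      ‖(fderiv ℝ (Kerr.bilin M a) (poincareInv L c x) (A (poincareInv L c x) + d)).bilinearComp
            (((L : E4 ≃L[ℝ] E4).symm : E4 →L[ℝ] E4)) (((L : E4 ≃L[ℝ] E4).symm : E4 →L[ℝ] E4)) +
          (Kerr.bilin M a (poincareInv L c x)).bilinearComp
            (A.comp (((L : E4 ≃L[ℝ] E4).symm : E4 →L[ℝ] E4))) (((L : E4 ≃L[ℝ] E4).symm : E4 →L[ℝ] E4)) +
          (Kerr.bilin M a (poincareInv L c x)).bilinearComp
            (((L : E4 ≃L[ℝ] E4).symm : E4 →L[ℝ] E4)) (A.comp (((L : E4 ≃L[ℝ] E4).symm : E4 →L[ℝ] E4)))‖ +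
        ‖fderiv ℝ (fun z ↦
          (fderiv ℝ (Kerr.bilin M a) (poincareInv L c z) (A (poincareInv L c z) + d)).bilinearComp
            (((L : E4 ≃L[ℝ] E4).symm : E4 →L[ℝ] E4)) (((L : E4 ≃L[ℝ] E4).symm : E4 →L[ℝ] E4)) +
          (Kerr.bilin M a (poincareInv L c z)).bilinearComp
            (A.comp (((L : E4 ≃L[ℝ] E4).symm : E4 →L[ℝ] E4))) (((L : E4 ≃L[ℝ] E4).symm : E4 →L[ℝ] E4)) +
          (Kerr.bilin M a (poincareInv L c z)).bilinearComp
            (((L : E4 ≃L[ℝ] E4).symm : E4 →L[ℝ] E4)) (A.comp (((L : E4 ≃L[ℝ] E4).symm : E4 →L[ℝ] E4))))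
          x‖ ≤ B * (‖A (E4.basisVector 0)‖ + ‖E4.spatial d‖ + ‖a • A (E4.basisVector 3)‖) := by
  set Γ : ℝ := 1 + 3 * |γ| with hΓ
  have hΓ1 : 1 ≤ Γ := by rw [hΓ]; linarith [abs_nonneg γ]
  set Ksh : Set E4 := {y : E4 | ‖y‖ ≤ Γ * |ρ| ∧ r ≤ Kerr.radius a y} with hKsh
  set O : Set E4 := {y : E4 | 0 < Kerr.radius a y} with hOdef
  have hO : IsOpen O := isOpen_lt continuous_const (Kerr.continuous_radius a)
  have hKO : Ksh ⊆ O := fun y hy ↦ lt_of_lt_of_le hr hy.2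
  have hKc : IsCompact Ksh := firstOrder_isCompact_restShell a _ _
  have hKd : ContDiffOn ℝ ((⊤ : ℕ∞) : WithTop ℕ∞) (Kerr.bilin M a) O := fun y hy ↦
    (Kerr.contDiffAt_bilin M a hy).contDiffWithinAt
  obtain ⟨C, hC0, hC⟩ := exists_forall_norm_iteratedFDeriv_le_of_isCompact hO hKd hKc hKO 2
  -- the constant
  set Cred : ℝ := 4 * (1 + |a|⁻¹) with hCred
  set B₁ : ℝ := Γ ^ 2 * (C * (Γ * |ρ| + 1) + 2 * (C + ‖(Minkowski.bilin : E4 →L[ℝ] E4 →L[ℝ] ℝ)‖)) +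
    Γ ^ 3 * (C * (Γ * |ρ| + 1) + 3 * C) with hB₁
  refine ⟨16 * Γ ^ 4 * C + B₁ * Cred, by positivity, fun L A d c x hL hA hxc hrad ↦ ?_⟩
  set S : E4 →L[ℝ] E4 := (((L : E4 ≃L[ℝ] E4).symm : E4 →L[ℝ] E4)) with hS
  set K : E4 → E4 →L[ℝ] E4 →L[ℝ] ℝ := Kerr.bilin M a with hK
  set y : E4 := poincareInv L c x with hy
  have hyS : y = S (x - c) := rfl
  have hSn : ‖S‖ ≤ Γ := by
    refine (norm_lorentz_symm_le' L).trans ?_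
    rw [hΓ]; linarith [hL.trans (le_abs_self γ)]
  have hS0 : 0 ≤ ‖S‖ := norm_nonneg _
  have hr0 : 0 < Kerr.radius a y := lt_of_lt_of_le hr hrad
  have hyK : y ∈ Ksh := by
    refine ⟨?_, hrad⟩
    calc ‖y‖ = ‖S (x - c)‖ := by rw [hyS]
      _ ≤ ‖S‖ * ‖x - c‖ := S.le_opNorm _
      _ ≤ Γ * |ρ| := mul_le_mul hSn (hxc.trans (le_abs_self ρ)) (norm_nonneg _) (by positivity)
  have hCk : ∀ k ≤ 2, ‖iteratedFDeriv ℝ k K y‖ ≤ C := fun k hk ↦ hC y hyK k hk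
  -- (1) the painted summand and its derivatives
  have hfunK : boostedKerrBilin L c M a = fun z ↦ (K (poincareInv L c z)).bilinearComp S S :=
    funext fun z ↦ firstOrder_boostedKerrBilin_eq_bilinearComp L c M a z
  set s : Set E4 := {z : E4 | 0 < Kerr.radius a (poincareInv L c z)} with hsdef
  have hso : IsOpen s :=
    isOpen_lt continuous_const ((Kerr.continuous_radius a).comp (continuous_poincareInv L c))
  have hxs : x ∈ s := hr0
  have hPc : ContDiffOn ℝ 2 (fun z ↦ K (poincareInv L c z)) s := fun z hz ↦
    ((Kerr.contDiffAt_bilin M a hz).comp z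
      ((contDiff_poincareInv L c).contDiffAt)).contDiffWithinAt
  have hPb : ∀ k ≤ 2, ‖iteratedFDeriv ℝ k (fun z ↦ K (poincareInv L c z)) x‖ ≤ Γ ^ 2 * C := by
    intro k hk
    refine (firstOrder_norm_iteratedFDeriv_comp_lorentz_le L c x K hO hr0 k).trans ?_
    calc ‖S‖ ^ k * ‖iteratedFDeriv ℝ k K y‖ ≤ Γ ^ k * C := by
          gcongr
          exact hCk k hk
      _ ≤ Γ ^ 2 * C := by gcongr
  have hΘ : ContDiff ℝ 2 (fun _ : ℝ ↦ S) := contDiff_const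
  have hΘb : ∀ k ≤ 2, ‖iteratedDeriv k (fun _ : ℝ ↦ S) (x 0)‖ ≤ Γ := by
    intro k _
    rw [iteratedDeriv_const]
    by_cases hk0 : k = 0
    · simpa [hk0] using hSn
    · simp only [hk0, if_false, norm_zero]
      positivity
  have hjet : ∀ m ≤ 2, ‖iteratedFDeriv ℝ m (boostedKerrBilin L c M a) x‖ ≤ 16 * Γ ^ 4 * C := by
    intro m hm
    rw [hfunK]
    have h := norm_iteratedFDeriv_bilinearComp_frame_le (m := m) hso hxs (hPc.of_le (by exact_mod_cast hm))
      (fun k hk ↦ hPb k (hk.trans hm)) (hΘ.of_le (by exact_mod_cast hm)) (fun k hk ↦ hΘb k (hk.trans hm))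
      (by positivity) (by positivity)
    refine h.trans ?_
    have h2 : (2 : ℝ) ^ m ≤ 2 ^ 2 := pow_le_pow_right₀ one_le_two hm
    calc (2 : ℝ) ^ m * 2 ^ m * Γ ^ 2 * (Γ ^ 2 * C) ≤ 2 ^ 2 * 2 ^ 2 * Γ ^ 2 * (Γ ^ 2 * C) := by gcongr
      _ = 16 * Γ ^ 4 * C := by ring
  obtain ⟨e1, e2⟩ := norm_fderiv_eq_norm_iteratedFDeriv (boostedKerrBilin L c M a) x
  -- (2) the variation field, with the reduced rate
  obtain ⟨A', d', hA', hnorm, hsame⟩ := firstOrder_lie_reduce M a hA d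
  have hcongr := firstOrder_variation_congr M a L c hsame hr0
  have hVx := hcongr.self_of_nhds
  dsimp only at hVx
  rw [hcongr.fderiv_eq, hVx]
  have hKC : ContDiffAt ℝ 2 K y := Kerr.contDiffAt_bilin M a hr0
  obtain ⟨L', hL', hnL'⟩ := firstOrder_hasFDerivAt_lie hKC A' d'
  have hfun : (fun z ↦ (fderiv ℝ K (poincareInv L c z) (A' (poincareInv L c z) + d')).bilinearComp S S +
      (K (poincareInv L c z)).bilinearComp (A'.comp S) S +
      (K (poincareInv L c z)).bilinearComp S (A'.comp S)) = fun z ↦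
      (fderiv ℝ K (S (z - c)) (A' (S (z - c)) + d') + (K (S (z - c))).comp A' +
        ((K (S (z - c))).flip.comp A').flip).bilinearComp S S := by
    funext z; rw [firstOrder_lie_bilinearComp_eq]; rfl
  obtain ⟨V', hV', -, hnV'⟩ := firstOrder_hasFDerivAt_pullback (F := fun y' ↦
    fderiv ℝ K y' (A' y' + d') + (K y').comp A' + ((K y').flip.comp A').flip) S c x hL'
  rw [hfun, hV'.fderiv]
  -- sizes at `y`
  obtain ⟨f1, f2⟩ := norm_fderiv_eq_norm_iteratedFDeriv K y
  have n0 : ‖K y - Minkowski.bilin‖ ≤ C + ‖(Minkowski.bilin : E4 →L[ℝ] E4 →L[ℝ] ℝ)‖ := by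
    refine (norm_sub_le _ _).trans (add_le_add ?_ le_rfl)
    have := hCk 0 (by norm_num)
    rwa [norm_iteratedFDeriv_zero] at this
  have n1 : ‖fderiv ℝ K y‖ ≤ C := by rw [f1]; exact hCk 1 (by norm_num)
  have n2 : ‖fderiv ℝ (fderiv ℝ K) y‖ ≤ C := by rw [f2]; exact hCk 2 le_rfl
  have nA : 0 ≤ ‖A'‖ := norm_nonneg _
  have nd : 0 ≤ ‖d'‖ := norm_nonneg _
  have hΓ0 : 0 ≤ Γ := zero_le_one.trans hΓ1
  have hyn : ‖y‖ ≤ Γ * |ρ| := hyK.1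
  set P : ℝ := ‖A'‖ + ‖d'‖ with hP
  have hP0 : 0 ≤ P := by positivity
  have hlin : ‖A'‖ * ‖y‖ + ‖d'‖ ≤ (Γ * |ρ| + 1) * P := by
    have h1 := mul_le_mul_of_nonneg_left hyn nA
    rw [hP]; nlinarith [mul_nonneg (mul_nonneg hΓ0 (abs_nonneg ρ)) nd, mul_nonneg (mul_nonneg hΓ0 (abs_nonneg ρ)) nA]
  have hAP : ‖A'‖ ≤ P := by rw [hP]; linarith
  -- size of the rest-frame field and of its derivative
  have hlie : ‖fderiv ℝ K y (A' y + d') + (K y).comp A' + ((K y).flip.comp A').flip‖ ≤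
      (C * (Γ * |ρ| + 1) + 2 * (C + ‖(Minkowski.bilin : E4 →L[ℝ] E4 →L[ℝ] ℝ)‖)) * P := by
    have hb := firstOrder_norm_lie_le (K := K) (y := y) (d := d') hA'
    have t1 : ‖fderiv ℝ K y‖ * (‖A'‖ * ‖y‖ + ‖d'‖) ≤ C * ((Γ * |ρ| + 1) * P) :=
      mul_le_mul n1 hlin (by positivity) hC0
    have t2 : 2 * ‖K y - Minkowski.bilin‖ * ‖A'‖ ≤
        2 * (C + ‖(Minkowski.bilin : E4 →L[ℝ] E4 →L[ℝ] ℝ)‖) * P :=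
      mul_le_mul (mul_le_mul_of_nonneg_left n0 zero_le_two) hAP nA (by positivity)
    calc _ ≤ _ := hb
      _ ≤ C * ((Γ * |ρ| + 1) * P) + 2 * (C + ‖(Minkowski.bilin : E4 →L[ℝ] E4 →L[ℝ] ℝ)‖) * P :=
          add_le_add t1 t2
      _ = _ := by ring
  have hL'b : ‖L'‖ ≤ (C * (Γ * |ρ| + 1) + 3 * C) * P := by
    have t1 : ‖fderiv ℝ (fderiv ℝ K) y‖ * (‖A'‖ * ‖y‖ + ‖d'‖) ≤ C * ((Γ * |ρ| + 1) * P) :=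
      mul_le_mul n2 hlin (by positivity) hC0
    have t2 : 3 * ‖fderiv ℝ K y‖ * ‖A'‖ ≤ 3 * C * P :=
      mul_le_mul (mul_le_mul_of_nonneg_left n1 (by norm_num)) hAP nA (by positivity)
    calc _ ≤ _ := hnL'
      _ ≤ C * ((Γ * |ρ| + 1) * P) + 3 * C * P := add_le_add t1 t2
      _ = _ := by ring
  have hSS : ‖S‖ * ‖S‖ ≤ Γ ^ 2 := by
    rw [sq]; exact mul_le_mul hSn hSn hS0 hΓ0
  have hS3 : ‖S‖ ^ 3 ≤ Γ ^ 3 := pow_le_pow_left₀ hS0 hSn 3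
  have hval : ‖(fderiv ℝ K (S (x - c)) (A' (S (x - c)) + d') + (K (S (x - c))).comp A' +
      ((K (S (x - c))).flip.comp A').flip).bilinearComp S S‖ ≤
      (C * (Γ * |ρ| + 1) + 2 * (C + ‖(Minkowski.bilin : E4 →L[ℝ] E4 →L[ℝ] ℝ)‖)) * P * Γ ^ 2 := by
    rw [← hyS]
    refine (firstOrder_norm_bilinearComp_le _ _ _).trans ?_
    rw [mul_assoc]
    exact mul_le_mul hlie hSS (mul_nonneg hS0 hS0) (by positivity)
  have hder : ‖V'‖ ≤ (C * (Γ * |ρ| + 1) + 3 * C) * P * Γ ^ 3 :=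
    hnV'.trans (mul_le_mul hL'b hS3 (by positivity) (by positivity))
  have hB₁P : (C * (Γ * |ρ| + 1) + 2 * (C + ‖(Minkowski.bilin : E4 →L[ℝ] E4 →L[ℝ] ℝ)‖)) * P * Γ ^ 2 +
      (C * (Γ * |ρ| + 1) + 3 * C) * P * Γ ^ 3 = B₁ * P := by rw [hB₁]; ring
  have hB₁0 : 0 ≤ B₁ := by positivity
  have hCred0 : 0 ≤ Cred := by positivity
  refine ⟨?_, ?_, ?_⟩
  · rw [e1]; exact (hjet 1 (by norm_num)).trans (le_add_of_nonneg_right (mul_nonneg hB₁0 hCred0))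
  · rw [e2]; exact (hjet 2 le_rfl).trans (le_add_of_nonneg_right (mul_nonneg hB₁0 hCred0))
  · have hred0 : 0 ≤ ‖A (E4.basisVector 0)‖ + ‖E4.spatial d‖ + ‖a • A (E4.basisVector 3)‖ := by
      positivity
    have hPle : P ≤ Cred * (‖A (E4.basisVector 0)‖ + ‖E4.spatial d‖ + ‖a • A (E4.basisVector 3)‖) :=
      hnorm
    calc _ ≤ B₁ * P := by rw [← hB₁P]; exact add_le_add hval hder
      _ ≤ B₁ * (Cred * (‖A (E4.basisVector 0)‖ + ‖E4.spatial d‖ + ‖a • A (E4.basisVector 3)‖)) :=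
          mul_le_mul_of_nonneg_left hPle hB₁0
      _ ≤ (16 * Γ ^ 4 * C + B₁ * Cred) *
          (‖A (E4.basisVector 0)‖ + ‖E4.spatial d‖ + ‖a • A (E4.basisVector 3)‖) := by
          have h0 : 0 ≤ 16 * Γ ^ 4 * C * (‖A (E4.basisVector 0)‖ + ‖E4.spatial d‖ +
            ‖a • A (E4.basisVector 3)‖) := by positivity
          have e : (16 * Γ ^ 4 * C + B₁ * Cred) *
              (‖A (E4.basisVector 0)‖ + ‖E4.spatial d‖ + ‖a • A (E4.basisVector 3)‖) =
            16 * Γ ^ 4 * C * (‖A (E4.basisVector 0)‖ + ‖E4.spatial d‖ + ‖a • A (E4.basisVector 3)‖) +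
            B₁ * (Cred * (‖A (E4.basisVector 0)‖ + ‖E4.spatial d‖ + ‖a • A (E4.basisVector 3)‖)) := by
            ring
          rw [e]; exact le_add_of_nonneg_left h0

/-! ### The far-field bound in terms of the reduced rate -/

-- the algebraic and the operator-norm instance paths on `E4 →L[ℝ] E4 →L[ℝ] ℝ` unify slowly
set_option synthInstance.maxHeartbeats 200000 in
set_option maxHeartbeats 800000 in
/-- **Far-field decay of the lab first-variation field in terms of the reduced rate**
(`firstOrder_far_variation` after `firstOrder_lie_reduce`): `‖V(x)‖ + ‖DV(x)‖ ≤
C (‖A e₀‖ + ‖d~‖ + ‖a · A e₃‖) / ‖x − c‖` at lab events of the slice through the centre with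
`‖x − c‖ ≥ max 1 (2|a|) + |a|`, uniformly over boosts with `|(Le₀)⁰| ≤ γ`. [cite: KerrSchild1965, §3] -/
theorem firstOrder_far_variation_red (M a γ : ℝ) :
    ∃ C : ℝ, 0 ≤ C ∧ ∀ (L : lorentzGroup) (A : E4 →L[ℝ] E4) (d c x : E4),
      |((L : E4 ≃L[ℝ] E4) (E4.basisVector 0)) 0| ≤ γ →
      (∀ u w : E4, Minkowski.bilin (A u) w + Minkowski.bilin u (A w) = 0) →
      (x - c) 0 = 0 → max 1 (2 * |a|) + |a| ≤ ‖x - c‖ →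
      ‖(fderiv ℝ (Kerr.bilin M a) (poincareInv L c x) (A (poincareInv L c x) + d)).bilinearComp
            (((L : E4 ≃L[ℝ] E4).symm : E4 →L[ℝ] E4)) (((L : E4 ≃L[ℝ] E4).symm : E4 →L[ℝ] E4)) +
          (Kerr.bilin M a (poincareInv L c x)).bilinearComp
            (A.comp (((L : E4 ≃L[ℝ] E4).symm : E4 →L[ℝ] E4))) (((L : E4 ≃L[ℝ] E4).symm : E4 →L[ℝ] E4)) +
          (Kerr.bilin M a (poincareInv L c x)).bilinearComp
            (((L : E4 ≃L[ℝ] E4).symm : E4 →L[ℝ] E4)) (A.comp (((L : E4 ≃L[ℝ] E4).symm : E4 →L[ℝ] E4)))‖ +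
        ‖fderiv ℝ (fun z ↦
          (fderiv ℝ (Kerr.bilin M a) (poincareInv L c z) (A (poincareInv L c z) + d)).bilinearComp
            (((L : E4 ≃L[ℝ] E4).symm : E4 →L[ℝ] E4)) (((L : E4 ≃L[ℝ] E4).symm : E4 →L[ℝ] E4)) +
          (Kerr.bilin M a (poincareInv L c z)).bilinearComp
            (A.comp (((L : E4 ≃L[ℝ] E4).symm : E4 →L[ℝ] E4))) (((L : E4 ≃L[ℝ] E4).symm : E4 →L[ℝ] E4)) +
          (Kerr.bilin M a (poincareInv L c z)).bilinearComp
            (((L : E4 ≃L[ℝ] E4).symm : E4 →L[ℝ] E4)) (A.comp (((L : E4 ≃L[ℝ] E4).symm : E4 →L[ℝ] E4))))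
          x‖ ≤ C * (‖A (E4.basisVector 0)‖ + ‖E4.spatial d‖ + ‖a • A (E4.basisVector 3)‖) / ‖x - c‖ := by
  obtain ⟨C, hC, h⟩ := firstOrder_far_variation M a γ
  refine ⟨C * (4 * (1 + |a|⁻¹)), by positivity, fun L A d c x hL hA hxc hfar ↦ ?_⟩
  obtain ⟨A', d', hA', hnorm, hsame⟩ := firstOrder_lie_reduce M a hA d
  -- positive radius at the far point
  have hrad : 0 < Kerr.radius a (poincareInv L c x) := by
    refine Kerr.radius_pos_of_abs_lt ?_
    have h1 := norm_le_spatialNorm_lorentz_apply L⁻¹ hxc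
    rw [coe_lorentz_inv] at h1
    have h2 : |a| < ‖x - c‖ := by
      have := le_max_left (1 : ℝ) (2 * |a|); linarith
    exact h2.trans_le h1
  have hcongr := firstOrder_variation_congr M a L c hsame hrad
  have hVx := hcongr.self_of_nhds
  dsimp only at hVx
  rw [hcongr.fderiv_eq, hVx]
  have hw0 : 0 < ‖x - c‖ := by
    have := le_max_left (1 : ℝ) (2 * |a|); linarith [abs_nonneg a]
  refine (h L A' d' c x hL hA' hxc hfar).trans ?_
  rw [div_le_div_iff_of_pos_right hw0, mul_assoc]
  exact mul_le_mul_of_nonneg_left hnorm hC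

/-- **Registered one-line carrier form** (`firstOrder_comp_lorentz_D7`, stub (D) of the crux item)
of `firstOrder_norm_iteratedFDeriv_comp_lorentz_le`. [folklore] -/
theorem firstOrder_comp_lorentz_D7 : open Literature.Geometry.Lorentzian in ∀ {F : Type} [NormedAddCommGroup F] [NormedSpace ℝ F] (L : lorentzGroup) (c x : E4) (g : E4 → F) {O : Set E4}, IsOpen O → poincareInv L c x ∈ O → ∀ k : ℕ, ‖iteratedFDeriv ℝ k (fun z ↦ g (poincareInv L c z)) x‖ ≤ ‖(((L : E4 ≃L[ℝ] E4).symm : E4 →L[ℝ] E4))‖ ^ k * ‖iteratedFDeriv ℝ k g (poincareInv L c x)‖ :=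
  fun L c x g _ hO hx k ↦ firstOrder_norm_iteratedFDeriv_comp_lorentz_le L c x g hO hx k

end Summit.FinalStateConjecture.FinalStateConjecture.Theorems.SublinearIsFree.Slaving

end
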